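import Mathlib
import HarnessLib
import Summits.Ventures.LatticeQCDFlow.Exactness.SphereLuscherGeneratorNormEquivalence
import Summits.Ventures.LatticeQCDFlow.Exactness.LatticeSiteLocality
import Summits.Ventures.LatticeQCDFlow.Exactness.RadialPolar
import Summits.Ventures.LatticeQCDFlow.Exactness.LatticeCoordAvg

/-!
# Variance tools for Lüscher's recursion on the lattice polynomials under the uniform product probability measure: transferred Bernstein / gap / Green, `(d−1)²·Var(X) ≤ Var(R)`, and the Cauchy–Schwarz–Bernstein source bound

HONEST FRAMING: exact (Metropolis-corrected) sampling algorithms for lattice gauge theory;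
figures of merit are autocorrelation/cost numbers at stated couplings and volumes; no
continuum-physics claim.

Venture `LatticeQCDFlow` (cell pub-lqcd), topic `Exactness`; FANOUT row 7 (`s0-cpn-null`: the
S0-D1 rung — 2D CP⁹, Lüscher's LO trivializing map inside HMC, Engel–Schaefer 2011).  NEW WORK of
the cell over Mathlib and the tree's `Exactness/SphereLatticeLaplacianSelfAdjoint.lean` (Bernstein
`Σ_k∫‖∂̃_k f‖² ≤ N(N+d−2)∫f²` under `⊗_Λ σ`), `Exactness/SphereLatticePolynomialPoincare.lean`
(gap `(d−1)∫(f−c₀)² ≤ Σ_k∫‖∂̃_k f‖²`, general `E`), `Exactness/SphereLuscherGeneratorNormEquivalence.lean`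
(`sub_const_mem_polyS`, `siteGrad_sub_const`), `Exactness/SphereLatticeGreen.lean`
(`∫ F·(−Σ∂̃²F) = Σ_k∫‖∂̃_kF‖²`, `∫ Σ∂̃²F = 0`), `Exactness/LatticeSiteLocality.lean` (`sdepOn`,
`section_eq_const_of_not_mem`), `Exactness/RadialPolar.lean` (`uniformSphere`) and
`Exactness/LatticeCoordAvg.lean` (`integrable_pi_of_continuous`); nothing is cited as a fact.
Printed counterpart, NAMED ONLY: M. Lüscher, Commun. Math. Phys. 293 (2010) 899, §3.3 (`𝔏₀` is
symmetric, nonnegative, null space the constants, hence boundedly invertible on their complement —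
here QUANTITATIVELY under the normalised product measure, on the lattice polynomials carrying every
order of the CP(N−1) series); Engel–Schaefer, Comput. Phys. Commun. 182 (2011) 2107, §3.  Toolbox of
the sequels `SphereLuscherLocalTermBounds` (volume-independent `L²` bounds on the local terms) and
`SphereLuscherSeriesExtensive` (`Var(S̃⁽ᵏ⁾) ≤ |Λ|·C_k`).  The tree's `SphereLatticeLuscherStability`
has `Var(X) ≤ Var(R)/(d−1)²` for all `C²` functionals but `E = ℝ^{m+2}` only; here `E` is general
and `X` a lattice polynomial (the case of the series).

## Setting

`E` finite-dimensional real inner product space, `d = dim E` (CP(N−1): `d = 2N`); `Λ` finite;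
`Ω = S(E)^Λ`; `σ = volume.toSphere`, `σ̄ = uniformSphere volume` (probability); `π̄ = ⊗_Λ σ̄`;
`F : (Λ → E) → ℝ` is read on `Ω` through `n ↦ (ω n : E)`; `Var(F) = ∫(F − ∫F dπ̄)² dπ̄`.

## Content

* §1 `pi_uniformSphere_eq_smul_pi_toSphere`, `integral_pi_uniformSphere_eq_mul`,
  `toReal_inv_toSphere_pow_pos` — `π̄ = σ(S)^{−|Λ|}·⊗_Λ σ` for general `E`, so homogeneous
  integral inequalities transfer from `⊗_Λ σ` to `π̄`: **`bernstein_polyS_uniform`**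
  (`Σ_k∫‖∂̃_kf‖²dπ̄ ≤ N(N+d−2)·∫(f−c₀)²dπ̄` for `f ∈ polyS N` and ANY shift `c₀`),
  `integral_mul_luscher_uniform` (`∫ f·(−Σ∂̃²f)dπ̄ = Σ_k∫‖∂̃_kf‖²dπ̄`), `integral_luscher_uniform_eq_zero`
  (`∫ Σ∂̃²f dπ̄ = 0`), `variance_le_integral_sub_const_sq` (`Var(h) ≤ ∫(h−c₀)²`),
  **`poincare_polyS_uniform`** (`(d−1)·Var(f) ≤ Σ_k∫‖∂̃_kf‖²dπ̄`, `d ≥ 2`).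
* §2 **`polyS_recursion_stable`** — if a lattice polynomial `X` solves `−Σ∂̃²X = R + c` on `Ω`, then
  `(d−1)²·Var(X) ≤ Var(R)` for every finite `Λ` (gap + Green + Young; `c = −∫R dπ̄` is forced).
* §3 SOURCE BOUNDS: **`sq_sum_inner_siteGrad_le`** (pointwise: `‖∂̃_kS‖ ≤ s` for all `k` and `∂̃_kX = 0` off `B` ⇒
  `(Σ_k⟪∂̃_kS, ∂̃_kX⟫)² ≤ s²·|B|·Σ_k‖∂̃_kX‖²`), **`integral_sq_source_le`** (integrated with Bernstein:
  `∫(Σ_k⟪∂̃_kS, ∂̃_kX⟫)²dπ̄ ≤ s²·|B|·M(M+d−2)·Var(X)` for `X ∈ polyS M`) — the `L²(π̄)` size of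
  Lüscher's next source `−Σ_k⟪∂̃_kS, ∂̃_kX⟫` is controlled by the fluctuation of `X`, the size of its
  footprint and a uniform bound on the force `∂̃S`, with no reference to `|Λ|`.

NOT CLAIMED: sup-norm bounds; anything for the interacting measure `e^{−S}dπ` or at flow time
`t > 0`; anything quantitative about the rung.
-/

noncomputable section

namespace Summit.Ventures.LatticeQCDFlow.Exactness

open Function Set Metric MeasureTheory NormedSpace InnerProductSpace
open scoped RealInnerProductSpace

variable {Λ : Type*} {E : Type*} [NormedAddCommGroup E] [InnerProductSpace ℝ E]
  [FiniteDimensional ℝ E] [MeasurableSpace E] [BorelSpace E]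

/-! ## §1 The uniform product probability measure and the transferred polynomial inequalities -/

section Measure

variable [Fintype Λ] [Nontrivial E]

/-- `⊗_Λ σ̄ = σ(S)^{−|Λ|} • ⊗_Λ σ` for a general finite-dimensional `E` (the tree's
`pi_uniformSphere_eq_smul_toSphere` is the `ℝ^{m+2}` instance). -/
theorem pi_uniformSphere_eq_smul_pi_toSphere :
    (Measure.pi fun _ : Λ => uniformSphere (volume : Measure E)) =
      ((((volume : Measure E).toSphere univ)⁻¹) ^ Fintype.card Λ) •
        Measure.pi fun _ : Λ => (volume : Measure E).toSphere := by
  refine Measure.pi_eq fun s _ => ?_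
  rw [Measure.smul_apply, Measure.pi_pi, smul_eq_mul]
  simp only [uniformSphere, Measure.smul_apply, smul_eq_mul]
  rw [Finset.prod_mul_distrib, Finset.prod_const, Finset.card_univ]

/-- Integrals against `⊗_Λ σ̄` are rescaled integrals against `⊗_Λ σ` (general `E`). -/
theorem integral_pi_uniformSphere_eq_mul (h : (Λ → sphere (0 : E) 1) → ℝ) :
    ∫ ω, h ω ∂Measure.pi (fun _ : Λ => uniformSphere (volume : Measure E)) =
      (((((volume : Measure E).toSphere univ)⁻¹) ^ Fintype.card Λ).toReal) *
        ∫ ω, h ω ∂Measure.pi (fun _ : Λ => (volume : Measure E).toSphere) := by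
  rw [pi_uniformSphere_eq_smul_pi_toSphere, integral_smul_measure, smul_eq_mul]

/-- The rescaling constant is positive. -/
theorem toReal_inv_toSphere_pow_pos :
    0 < (((((volume : Measure E).toSphere univ)⁻¹) ^ Fintype.card Λ).toReal) := by
  apply ENNReal.toReal_pos
  · exact pow_ne_zero _ (ENNReal.inv_ne_zero.2 (measure_ne_top _ _))
  · exact ENNReal.pow_ne_top (ENNReal.inv_ne_top.2 volume_toSphere_univ_ne_zero)

variable [DecidableEq Λ]

/-- **Bernstein under `π̄`, with an arbitrary shift**: for a lattice polynomial `f` of degree `≤ N`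
and every constant `c₀`, `Σ_k ∫‖∂̃_k f‖² dπ̄ ≤ N(N+d−2)·∫(f − c₀)² dπ̄`. -/
theorem bernstein_polyS_uniform (N : ℕ) {f : (Λ → E) → ℝ} (hf : f ∈ polyS Λ E N) (c₀ : ℝ) :
    ∑ k, ∫ ω, ‖siteGrad k f (fun n => ((ω : Λ → sphere (0 : E) 1) n : E))‖ ^ 2
        ∂Measure.pi (fun _ : Λ => uniformSphere (volume : Measure E)) ≤
      (N : ℝ) * (N + (Module.finrank ℝ E : ℝ) - 2) *
        ∫ ω, (f (fun n => ((ω : Λ → sphere (0 : E) 1) n : E)) - c₀) ^ 2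
          ∂Measure.pi (fun _ : Λ => uniformSphere (volume : Measure E)) := by
  have h := bernstein_polyS (Λ := Λ) N (sub_const_mem_polyS hf c₀)
  simp_rw [siteGrad_sub_const] at h
  simp_rw [integral_pi_uniformSphere_eq_mul, ← Finset.mul_sum]
  calc _ ≤ (((((volume : Measure E).toSphere univ)⁻¹) ^ Fintype.card Λ).toReal) *
        ((N : ℝ) * (N + (Module.finrank ℝ E : ℝ) - 2) *
          ∫ ω, (f (fun n => ((ω : Λ → sphere (0 : E) 1) n : E)) - c₀) ^ 2
            ∂Measure.pi (fun _ : Λ => (volume : Measure E).toSphere)) :=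
        mul_le_mul_of_nonneg_left h toReal_inv_toSphere_pow_pos.le
    _ = _ := by ring

/-- **The Dirichlet form under `π̄`**: `∫ f·(−Σ_k ∂̃_k·∂̃_k f) dπ̄ = Σ_k ∫‖∂̃_k f‖² dπ̄` (`f ∈ C²`). -/
theorem integral_mul_luscher_uniform {F : (Λ → E) → ℝ} (hF : ContDiff ℝ 2 F) :
    ∫ ω, F (fun n => ((ω : Λ → sphere (0 : E) 1) n : E)) *
        -∑ k, siteLaplacian k F (fun n => (ω n : E))
        ∂Measure.pi (fun _ : Λ => uniformSphere (volume : Measure E)) =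
      ∑ k, ∫ ω, ‖siteGrad k F (fun n => ((ω : Λ → sphere (0 : E) 1) n : E))‖ ^ 2
        ∂Measure.pi (fun _ : Λ => uniformSphere (volume : Measure E)) := by
  simp_rw [integral_pi_uniformSphere_eq_mul, ← Finset.mul_sum,
    integral_mul_neg_sum_siteLaplacian_self hF]

/-- **The range of `𝔏₀` is orthogonal to the constants under `π̄`**: `∫ Σ_k ∂̃_k·∂̃_k F dπ̄ = 0`. -/
theorem integral_luscher_uniform_eq_zero {F : (Λ → E) → ℝ} (hF : ContDiff ℝ 2 F) :
    ∫ ω, ∑ k, siteLaplacian k F (fun n => ((ω : Λ → sphere (0 : E) 1) n : E))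
        ∂Measure.pi (fun _ : Λ => uniformSphere (volume : Measure E)) = 0 := by
  rw [integral_pi_uniformSphere_eq_mul, integral_sum_siteLaplacian_eq_zero hF, mul_zero]

omit [DecidableEq Λ] in
/-- On a probability space the variance is the least mean-square deviation from a constant:
`∫(h − ∫h)² ≤ ∫(h − c₀)²` (continuous `h` on the compact product of spheres). -/
theorem variance_le_integral_sub_const_sq {h : (Λ → sphere (0 : E) 1) → ℝ} (hc : Continuous h)
    (c₀ : ℝ) :
    ∫ ω, (h ω - ∫ ω', h ω' ∂Measure.pi (fun _ : Λ => uniformSphere (volume : Measure E))) ^ 2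
        ∂Measure.pi (fun _ : Λ => uniformSphere (volume : Measure E)) ≤
      ∫ ω, (h ω - c₀) ^ 2 ∂Measure.pi (fun _ : Λ => uniformSphere (volume : Measure E)) := by
  set μ : Measure (sphere (0 : E) 1) := uniformSphere (volume : Measure E) with hμ
  set m : ℝ := ∫ ω', h ω' ∂Measure.pi (fun _ : Λ => μ) with hm
  have hi : Integrable h (Measure.pi fun _ : Λ => μ) := integrable_pi_of_continuous μ hc
  have hi2 : Integrable (fun ω => (h ω - c₀) ^ 2) (Measure.pi fun _ : Λ => μ) :=
    integrable_pi_of_continuous μ ((hc.sub continuous_const).pow 2)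
  have hlin : Integrable (fun ω => 2 * (m - c₀) * (h ω - c₀)) (Measure.pi fun _ : Λ => μ) :=
    (hi.sub (integrable_const c₀)).const_mul _
  have hfun : (fun ω => (h ω - m) ^ 2) =
      fun ω => (h ω - c₀) ^ 2 - 2 * (m - c₀) * (h ω - c₀) + (m - c₀) ^ 2 := by
    funext ω; ring
  have hmean : ∫ ω, (h ω - c₀) ∂Measure.pi (fun _ : Λ => μ) = m - c₀ := by
    rw [integral_sub hi (integrable_const c₀), integral_const, smul_eq_mul, Measure.real,
      measure_univ, ENNReal.toReal_one, one_mul]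
  have hA : Integrable (fun ω => (h ω - c₀) ^ 2 - 2 * (m - c₀) * (h ω - c₀))
      (Measure.pi fun _ : Λ => μ) := hi2.sub hlin
  rw [hfun, integral_add hA (integrable_const _), integral_sub hi2 hlin,
    integral_const_mul, hmean, integral_const, smul_eq_mul, Measure.real, measure_univ,
    ENNReal.toReal_one, one_mul]
  nlinarith [sq_nonneg (m - c₀)]

/-- **The spectral gap under `π̄` for lattice polynomials** (`d = dim E ≥ 2`, any finite `Λ`):
`(d−1)·Var(f) ≤ Σ_k ∫‖∂̃_k f‖² dπ̄`. -/
theorem poincare_polyS_uniform (h2 : 2 ≤ Module.finrank ℝ E) {N : ℕ} {f : (Λ → E) → ℝ}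
    (hf : f ∈ polyS Λ E N) :
    ((Module.finrank ℝ E : ℝ) - 1) *
        ∫ ω, (f (fun n => ((ω : Λ → sphere (0 : E) 1) n : E)) -
          ∫ ω', f (fun n => ((ω' : Λ → sphere (0 : E) 1) n : E))
            ∂Measure.pi (fun _ : Λ => uniformSphere (volume : Measure E))) ^ 2
          ∂Measure.pi (fun _ : Λ => uniformSphere (volume : Measure E)) ≤
      ∑ k, ∫ ω, ‖siteGrad k f (fun n => ((ω : Λ → sphere (0 : E) 1) n : E))‖ ^ 2
        ∂Measure.pi (fun _ : Λ => uniformSphere (volume : Measure E)) := by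
  obtain ⟨c₀, hc₀⟩ := poincare_polyS (Λ := Λ) h2 hf
  have hd : 0 ≤ (Module.finrank ℝ E : ℝ) - 1 := by
    have : (2 : ℝ) ≤ Module.finrank ℝ E := by exact_mod_cast h2
    linarith
  have hcont : Continuous fun ω : Λ → sphere (0 : E) 1 => f (fun n => (ω n : E)) :=
    (contDiff_of_mem_polyS hf).continuous.comp continuous_sphereConfig
  -- transfer the shifted inequality to `π̄`
  have h1 : ((Module.finrank ℝ E : ℝ) - 1) *
      ∫ ω, (f (fun n => ((ω : Λ → sphere (0 : E) 1) n : E)) - c₀) ^ 2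
        ∂Measure.pi (fun _ : Λ => uniformSphere (volume : Measure E)) ≤
      ∑ k, ∫ ω, ‖siteGrad k f (fun n => ((ω : Λ → sphere (0 : E) 1) n : E))‖ ^ 2
        ∂Measure.pi (fun _ : Λ => uniformSphere (volume : Measure E)) := by
    simp_rw [integral_pi_uniformSphere_eq_mul, ← Finset.mul_sum]
    calc _ = (((((volume : Measure E).toSphere univ)⁻¹) ^ Fintype.card Λ).toReal) *
          (((Module.finrank ℝ E : ℝ) - 1) *
            ∫ ω, (f (fun n => ((ω : Λ → sphere (0 : E) 1) n : E)) - c₀) ^ 2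
              ∂Measure.pi (fun _ : Λ => (volume : Measure E).toSphere)) := by ring
      _ ≤ _ := mul_le_mul_of_nonneg_left hc₀ toReal_inv_toSphere_pow_pos.le
  exact (mul_le_mul_of_nonneg_left (variance_le_integral_sub_const_sq hcont c₀) hd).trans h1

end Measure

/-! ## §2 `L²(π̄)`-stability of the recursion for lattice polynomials, general `E` -/

section Stability

variable [Fintype Λ] [DecidableEq Λ] [Nontrivial E]

/-- **`(d−1)²·Var(X) ≤ Var(R)` along Lüscher's recursion.**  If a lattice polynomial `X` solves
`−Σ_k ∂̃_k·∂̃_k X = R + c` on the product of unit spheres, then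
`(d−1)²·∫(X − ∫X dπ̄)² dπ̄ ≤ ∫(R − ∫R dπ̄)² dπ̄` for every finite `Λ` (general finite-dimensional `E`,
`d = dim E ≥ 2`; the gap for polynomials + Young's inequality; the constant is fixed by
`∫ 𝔏₀X dπ̄ = 0`, i.e. `c = −∫R dπ̄`). -/
theorem polyS_recursion_stable (h2 : 2 ≤ Module.finrank ℝ E) {M : ℕ} {X : (Λ → E) → ℝ}
    (hX : X ∈ polyS Λ E M) {R : (Λ → E) → ℝ} {c : ℝ}
    (hrec : ∀ ω : Λ → sphere (0 : E) 1,
      -∑ k, siteLaplacian k X (fun n => (ω n : E)) = R (fun n => (ω n : E)) + c) :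
    ((Module.finrank ℝ E : ℝ) - 1) ^ 2 *
        ∫ ω, (X (fun n => ((ω : Λ → sphere (0 : E) 1) n : E)) -
          ∫ ω', X (fun n => ((ω' : Λ → sphere (0 : E) 1) n : E))
            ∂Measure.pi (fun _ : Λ => uniformSphere (volume : Measure E))) ^ 2
          ∂Measure.pi (fun _ : Λ => uniformSphere (volume : Measure E)) ≤
      ∫ ω, (R (fun n => ((ω : Λ → sphere (0 : E) 1) n : E)) -
          ∫ ω', R (fun n => ((ω' : Λ → sphere (0 : E) 1) n : E))
            ∂Measure.pi (fun _ : Λ => uniformSphere (volume : Measure E))) ^ 2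
        ∂Measure.pi (fun _ : Λ => uniformSphere (volume : Measure E)) := by
  -- abbreviations (reals only; the functions are kept explicit)
  have hX2 : ContDiff ℝ 2 X := polyS_contDiff_two M X hX
  have hGc : Continuous fun ω : Λ → sphere (0 : E) 1 => X (fun n => (ω n : E)) :=
    hX2.continuous.comp continuous_sphereConfig
  have hsum : ∀ ω : Λ → sphere (0 : E) 1,
      ∑ k, siteLaplacian k X (fun n => (ω n : E)) = -(R (fun n => (ω n : E)) + c) := fun ω => by
    rw [← hrec ω, neg_neg]
  have hRc : Continuous fun ω : Λ → sphere (0 : E) 1 => R (fun n => (ω n : E)) := by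
    have hfun : (fun ω : Λ → sphere (0 : E) 1 => R (fun n => (ω n : E))) =
        fun ω => -∑ k, siteLaplacian k X (fun n => (ω n : E)) - c := by
      funext ω; rw [hrec ω]; ring
    rw [hfun]
    exact (continuous_finsetSum Finset.univ fun k _ =>
      continuous_siteLaplacian_sphereConfig hX2 k).neg.sub continuous_const
  have hd : 0 ≤ (Module.finrank ℝ E : ℝ) - 1 := by
    have : (2 : ℝ) ≤ Module.finrank ℝ E := by exact_mod_cast h2
    linarith
  -- the two means
  set mX : ℝ := ∫ ω', X (fun n => ((ω' : Λ → sphere (0 : E) 1) n : E))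
    ∂Measure.pi (fun _ : Λ => uniformSphere (volume : Measure E)) with hmX
  set mR : ℝ := ∫ ω', R (fun n => ((ω' : Λ → sphere (0 : E) 1) n : E))
    ∂Measure.pi (fun _ : Λ => uniformSphere (volume : Measure E)) with hmR
  -- integrability
  have hiG : Integrable (fun ω : Λ → sphere (0 : E) 1 => X (fun n => (ω n : E)))
      (Measure.pi fun _ : Λ => uniformSphere (volume : Measure E)) :=
    integrable_pi_of_continuous _ hGc
  have hiR : Integrable (fun ω : Λ → sphere (0 : E) 1 => R (fun n => (ω n : E)))
      (Measure.pi fun _ : Λ => uniformSphere (volume : Measure E)) :=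
    integrable_pi_of_continuous _ hRc
  have hiV : Integrable (fun ω : Λ → sphere (0 : E) 1 => (X (fun n => (ω n : E)) - mX) ^ 2)
      (Measure.pi fun _ : Λ => uniformSphere (volume : Measure E)) :=
    integrable_pi_of_continuous _ ((hGc.sub continuous_const).pow 2)
  have hiW : Integrable (fun ω : Λ → sphere (0 : E) 1 => (R (fun n => (ω n : E)) - mR) ^ 2)
      (Measure.pi fun _ : Λ => uniformSphere (volume : Measure E)) :=
    integrable_pi_of_continuous _ ((hRc.sub continuous_const).pow 2)
  have hiI : Integrable (fun ω : Λ → sphere (0 : E) 1 =>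
      (X (fun n => (ω n : E)) - mX) * (R (fun n => (ω n : E)) - mR))
      (Measure.pi fun _ : Λ => uniformSphere (volume : Measure E)) :=
    integrable_pi_of_continuous _ ((hGc.sub continuous_const).mul (hRc.sub continuous_const))
  have hi1 : Integrable (fun ω : Λ → sphere (0 : E) 1 =>
      (X (fun n => (ω n : E)) - mX) * (R (fun n => (ω n : E)) - mR) + mX * R (fun n => (ω n : E)))
      (Measure.pi fun _ : Λ => uniformSphere (volume : Measure E)) := hiI.add (hiR.const_mul mX)
  -- (1) the constant: `∫ (R + c) = 0`, i.e. `c = -mR`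
  have hc : c = -mR := by
    have h0 := integral_luscher_uniform_eq_zero (Λ := Λ) hX2
    simp_rw [hsum, integral_neg, neg_eq_zero] at h0
    rw [integral_add hiR (integrable_const c), integral_const, smul_eq_mul, Measure.real,
      measure_univ, ENNReal.toReal_one, one_mul] at h0
    linarith
  -- (2) the gap and the Dirichlet form: `(d−1)·V ≤ Σ∫‖∂̃X‖² = ∫ X·(R + c) = ∫ (X − mX)(R − mR)`
  have hgap := poincare_polyS_uniform (Λ := Λ) h2 hX
  have hdir := integral_mul_luscher_uniform (Λ := Λ) hX2
  have hI : ∑ k, ∫ ω, ‖siteGrad k X (fun n => ((ω : Λ → sphere (0 : E) 1) n : E))‖ ^ 2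
      ∂Measure.pi (fun _ : Λ => uniformSphere (volume : Measure E)) =
      ∫ ω, (X (fun n => ((ω : Λ → sphere (0 : E) 1) n : E)) - mX) * (R (fun n => (ω n : E)) - mR)
        ∂Measure.pi (fun _ : Λ => uniformSphere (volume : Measure E)) := by
    rw [← hdir]
    have hfun : (fun ω : Λ → sphere (0 : E) 1 => X (fun n => (ω n : E)) *
        -∑ k, siteLaplacian k X (fun n => (ω n : E))) =
        fun ω => (X (fun n => (ω n : E)) - mX) * (R (fun n => (ω n : E)) - mR) +
          mX * R (fun n => (ω n : E)) - mX * mR := by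
      funext ω; rw [hrec ω, hc]; ring
    rw [hfun, integral_sub hi1 (integrable_const _), integral_add hiI (hiR.const_mul mX),
      integral_const_mul, integral_const, smul_eq_mul, Measure.real, measure_univ,
      ENNReal.toReal_one, one_mul, ← hmR]
    ring
  rw [hI] at hgap
  -- (3) Young: `2(d−1)·(X − mX)(R − mR) ≤ (d−1)²·(X − mX)² + (R − mR)²`, integrated
  have hyoung : 2 * ((Module.finrank ℝ E : ℝ) - 1) *
      ∫ ω, (X (fun n => ((ω : Λ → sphere (0 : E) 1) n : E)) - mX) * (R (fun n => (ω n : E)) - mR)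
        ∂Measure.pi (fun _ : Λ => uniformSphere (volume : Measure E)) ≤
      ((Module.finrank ℝ E : ℝ) - 1) ^ 2 *
          ∫ ω, (X (fun n => ((ω : Λ → sphere (0 : E) 1) n : E)) - mX) ^ 2
            ∂Measure.pi (fun _ : Λ => uniformSphere (volume : Measure E)) +
        ∫ ω, (R (fun n => ((ω : Λ → sphere (0 : E) 1) n : E)) - mR) ^ 2
          ∂Measure.pi (fun _ : Λ => uniformSphere (volume : Measure E)) := by
    rw [← integral_const_mul, ← integral_const_mul, ← integral_add (hiV.const_mul _) hiW]
    refine integral_mono (hiI.const_mul _) ((hiV.const_mul _).add hiW) fun ω => ?_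
    nlinarith [sq_nonneg (((Module.finrank ℝ E : ℝ) - 1) * (X (fun n => (ω n : E)) - mX) -
      (R (fun n => (ω n : E)) - mR))]
  -- (4) combine
  have hVnn : 0 ≤ ∫ ω, (X (fun n => ((ω : Λ → sphere (0 : E) 1) n : E)) - mX) ^ 2
      ∂Measure.pi (fun _ : Λ => uniformSphere (volume : Measure E)) :=
    integral_nonneg fun ω => sq_nonneg _
  nlinarith [hgap, hyoung, hd, hVnn]

end Stability

/-! ## §3 The source of the next order: pointwise Cauchy–Schwarz and the integrated bound -/

section Source

variable [Fintype Λ] [DecidableEq Λ]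

omit [MeasurableSpace E] [BorelSpace E] in
/-- **Pointwise Cauchy–Schwarz for the source**: if `‖∂̃_k S‖ ≤ s` at `x` for every `k` and
`∂̃_k X = 0` at `x` for `k ∉ B`, then `(Σ_k ⟪∂̃_k S, ∂̃_k X⟫)² ≤ s²·|B|·Σ_k ‖∂̃_k X‖²`. -/
theorem sq_sum_inner_siteGrad_le {S X : (Λ → E) → ℝ} {s : ℝ} {x : Λ → E}
    (hS : ∀ k, ‖siteGrad k S x‖ ≤ s) {B : Finset Λ} (hXB : ∀ k ∉ B, siteGrad k X x = 0) :
    (∑ k, ⟪siteGrad k S x, siteGrad k X x⟫) ^ 2 ≤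
      s ^ 2 * B.card * ∑ k, ‖siteGrad k X x‖ ^ 2 := by
  have h1 : |∑ k, ⟪siteGrad k S x, siteGrad k X x⟫| ≤ s * ∑ k ∈ B, ‖siteGrad k X x‖ := by
    calc |∑ k, ⟪siteGrad k S x, siteGrad k X x⟫|
        ≤ ∑ k, |⟪siteGrad k S x, siteGrad k X x⟫| := Finset.abs_sum_le_sum_abs _ _
      _ ≤ ∑ k, s * ‖siteGrad k X x‖ := Finset.sum_le_sum fun k _ =>
          (abs_real_inner_le_norm _ _).trans
            (mul_le_mul_of_nonneg_right (hS k) (norm_nonneg _))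
      _ = s * ∑ k, ‖siteGrad k X x‖ := by rw [Finset.mul_sum]
      _ = s * ∑ k ∈ B, ‖siteGrad k X x‖ := by
          congr 1
          refine (Finset.sum_subset (Finset.subset_univ B) fun k _ hk => ?_).symm
          rw [hXB k hk, norm_zero]
  have h2 : (∑ k ∈ B, ‖siteGrad k X x‖) ^ 2 ≤ B.card * ∑ k ∈ B, ‖siteGrad k X x‖ ^ 2 :=
    sq_sum_le_card_mul_sum_sq
  have h3 : ∑ k ∈ B, ‖siteGrad k X x‖ ^ 2 ≤ ∑ k, ‖siteGrad k X x‖ ^ 2 :=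
    Finset.sum_le_sum_of_subset_of_nonneg (Finset.subset_univ B) fun k _ _ => sq_nonneg _
  calc (∑ k, ⟪siteGrad k S x, siteGrad k X x⟫) ^ 2
      = |∑ k, ⟪siteGrad k S x, siteGrad k X x⟫| ^ 2 := (sq_abs _).symm
    _ ≤ (s * ∑ k ∈ B, ‖siteGrad k X x‖) ^ 2 := pow_le_pow_left₀ (abs_nonneg _) h1 2
    _ = s ^ 2 * (∑ k ∈ B, ‖siteGrad k X x‖) ^ 2 := by ring
    _ ≤ s ^ 2 * (B.card * ∑ k ∈ B, ‖siteGrad k X x‖ ^ 2) :=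
        mul_le_mul_of_nonneg_left h2 (sq_nonneg _)
    _ ≤ s ^ 2 * (B.card * ∑ k, ‖siteGrad k X x‖ ^ 2) := by gcongr
    _ = s ^ 2 * B.card * ∑ k, ‖siteGrad k X x‖ ^ 2 := by ring

variable [Nontrivial E]

/-- **The integrated source bound**: for a lattice polynomial `X` of degree `≤ M` whose site
gradients vanish outside `B`, and `‖∂̃_k S‖ ≤ s` on the product of unit spheres (`S ∈ C¹`),
`∫ (Σ_k⟪∂̃_k S, ∂̃_k X⟫)² dπ̄ ≤ s²·|B|·M(M+d−2)·Var(X)` (pointwise Cauchy–Schwarz + Bernstein). -/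
theorem integral_sq_source_le {M : ℕ} {X : (Λ → E) → ℝ} (hX : X ∈ polyS Λ E M) {B : Finset Λ}
    (hXB : ∀ k ∉ B, ∀ x, siteGrad k X x = 0) {S : (Λ → E) → ℝ} (hS : ContDiff ℝ 1 S) {s : ℝ}
    (hSle : ∀ ω : Λ → sphere (0 : E) 1, ∀ k, ‖siteGrad k S (fun n => (ω n : E))‖ ≤ s) :
    ∫ ω, (∑ k, ⟪siteGrad k S (fun n => ((ω : Λ → sphere (0 : E) 1) n : E)),
        siteGrad k X (fun n => (ω n : E))⟫) ^ 2
        ∂Measure.pi (fun _ : Λ => uniformSphere (volume : Measure E)) ≤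
      s ^ 2 * B.card * ((M : ℝ) * (M + (Module.finrank ℝ E : ℝ) - 2)) *
        ∫ ω, (X (fun n => ((ω : Λ → sphere (0 : E) 1) n : E)) -
          ∫ ω', X (fun n => ((ω' : Λ → sphere (0 : E) 1) n : E))
            ∂Measure.pi (fun _ : Λ => uniformSphere (volume : Measure E))) ^ 2
          ∂Measure.pi (fun _ : Λ => uniformSphere (volume : Measure E)) := by
  set μ : Measure (sphere (0 : E) 1) := uniformSphere (volume : Measure E) with hμ
  have hX1 : ContDiff ℝ 1 X := contDiff_infty.1 (contDiff_of_mem_polyS hX) 1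
  have hs2 : 0 ≤ s ^ 2 * B.card := mul_nonneg (sq_nonneg _) (Nat.cast_nonneg _)
  -- pointwise bound, integrated
  have hpt : ∀ ω : Λ → sphere (0 : E) 1,
      (∑ k, ⟪siteGrad k S (fun n => (ω n : E)), siteGrad k X (fun n => (ω n : E))⟫) ^ 2 ≤
        s ^ 2 * B.card * ∑ k, ‖siteGrad k X (fun n => (ω n : E))‖ ^ 2 := fun ω =>
    sq_sum_inner_siteGrad_le (hSle ω) fun k hk => hXB k hk _
  have hiL : Integrable (fun ω : Λ → sphere (0 : E) 1 =>
      (∑ k, ⟪siteGrad k S (fun n => (ω n : E)), siteGrad k X (fun n => (ω n : E))⟫) ^ 2)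
      (Measure.pi fun _ : Λ => μ) :=
    integrable_pi_of_continuous μ ((continuous_finsetSum Finset.univ fun k _ =>
      continuous_inner_siteGrad hX1 hS k k).pow 2)
  have hiG : ∀ k, Integrable (fun ω : Λ → sphere (0 : E) 1 =>
      ‖siteGrad k X (fun n => (ω n : E))‖ ^ 2) (Measure.pi fun _ : Λ => μ) := fun k =>
    integrable_pi_of_continuous μ ((continuous_siteGrad_sphereConfig hX1 k).norm.pow 2)
  have hiR : Integrable (fun ω : Λ → sphere (0 : E) 1 =>
      s ^ 2 * B.card * ∑ k, ‖siteGrad k X (fun n => (ω n : E))‖ ^ 2) (Measure.pi fun _ : Λ => μ) :=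
    (integrable_finsetSum Finset.univ fun k _ => hiG k).const_mul _
  have h1 := integral_mono hiL hiR hpt
  rw [integral_const_mul, integral_finsetSum Finset.univ fun k _ => hiG k] at h1
  -- Bernstein with the mean as shift
  have h2 := bernstein_polyS_uniform (Λ := Λ) M hX
    (∫ ω', X (fun n => ((ω' : Λ → sphere (0 : E) 1) n : E)) ∂Measure.pi (fun _ : Λ => μ))
  calc _ ≤ s ^ 2 * B.card * ∑ k, ∫ ω, ‖siteGrad k X (fun n => ((ω : Λ → sphere (0 : E) 1) n : E))‖ ^ 2
        ∂Measure.pi (fun _ : Λ => μ) := h1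
    _ ≤ s ^ 2 * B.card * (((M : ℝ) * (M + (Module.finrank ℝ E : ℝ) - 2)) *
        ∫ ω, (X (fun n => ((ω : Λ → sphere (0 : E) 1) n : E)) -
          ∫ ω', X (fun n => ((ω' : Λ → sphere (0 : E) 1) n : E)) ∂Measure.pi (fun _ : Λ => μ)) ^ 2
          ∂Measure.pi (fun _ : Λ => μ)) := mul_le_mul_of_nonneg_left h2 hs2
    _ = _ := by ring

end Source

end Summit.Ventures.LatticeQCDFlow.Exactness

end
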